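import Mathlib.RingTheory.NoetherNormalization
import Mathlib.RingTheory.Ideal.MinimalPrime.Noetherian
import Literature.RingTheory.NoetherNormalization.HypersurfaceModel
import Literature.NumberTheory.DiophantineGeometry.AbsIrreducibleOfNonsingularPoint
import HarnessLib

/-!
# Rational-trace decomposition of the rational points of an affine algebraic set (perfect field)

Topic `Literature/NumberTheory/DiophantineGeometry`.  This is the qualitative, field-uniform half
of the classical reduction of the Lang–Weil estimate for an arbitrary affine algebraic set to the
case of an absolutely irreducible hypersurface (Lang–Weil 1954, §2; in coordinates through
Hartshorne I Prop. 4.9 "every variety of dimension `d` is birational to a hypersurface in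
`𝐀^{d+1}`" and Noether normalisation), stated purely in terms of POINT SETS and POLYNOMIALS so
that it can be written as a first-order formula and transferred from pseudo-finite to finite
fields (`Literature/ModelTheory/PseudofiniteFields/LangWeilShapeTransfer.lean`) and then counted
(`…/DefinableSetsFiniteFieldsProp33Proofs.lean`, Chatzidakis–van den Dries–Macintyre Prop. 3.3).

**Theorem A** (`exists_decomposition`, `hasDecomposition_ratPoints`).  Let `K` be a perfect field
and `V ⊆ Kⁿ` the set of `K`-rational zeros of an ideal `J ⊆ K[X₁, …, Xₙ]`.  Then `V = ∅`, or for
some bound `B` there is a `Decomposition K n V B`: a dimension `d ≤ n`, good pieces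
`i < μ` (`1 ≤ μ ≤ B`) each given by parameters `T_i : Kⁿ → K^d`, a primitive coordinate `U_i`, an
absolutely irreducible `m_i ∈ K[X₀, X₁, …, X_d]` monic in `X₀`, a denominator `δ_i ≠ 0` and
numerators `w_{ij}`, with piece
`Z°_i = {x | δ_i(T_i x) ≠ 0, m_i(U_i x, T_i x) = 0, δ_i(T_i x)·x_j = w_{ij}(U_i x, T_i x) ∀ j}`,
and `L ≤ B` Noether charts `{x | N_{lj}(x_j, T'_l x) = 0 ∀ j}` with `d - 1` parameters and `N_{lj}`
monic in `X₀` (no chart when `d = 0`), all polynomials of degree `≤ B`, such that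
(a) `Z°_i ⊆ V`; (b) `V ⊆ ⋃_l charts ∪ ⋃_i Z°_i`; (c) `Z°_i ∩ Z°_{i'} ⊆ ⋃_l charts` for `i ≠ i'`;
(d) `(y, v) ↦ x` inverts `x ↦ (T_i x, U_i x)` on `Z°_i`: every `x` with `δ_i(y) x = w_i(v, y)` for a
zero `(v, y)` of `m_i` with `δ_i(y) ≠ 0` has `T_i x = y`, `U_i x = v`.

Proof (all in this file, no new facts).  Induction on `d` over finite sets of ideals of dimension
`< d` (`hasDecomposition_biUnion`): pass to the minimal primes (`mem_ratPoints_iff_exists_minimalPrimes`);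
every prime `P` of top dimension `d` carries `ModelData P d` (the birational hypersurface model of
`HypersurfaceModel.lean` with `d` prescribed), whose piece satisfies (a), (d) and
`V(P) ⊆ Z° ∪ V(P + (δρ))` (`ModelData.piece_mem_or_mem_exc`); if the model polynomial is NOT
absolutely irreducible then all rational zeros of `m` are singular
(`eval_pderiv_eq_zero_of_irreducible_of_not_isAbsIrreducible`, `K` perfect) so the Bézout identity
`a m + b ∂_T m = ρ` forces `V(P)(K) ⊆ V(P + (δρ))` (`ModelData.mem_exc_of_bad`); the exceptional
ideals `P + (δρ)`, `P + P'` (distinct top primes) and the non-top primes have dimension `< d`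
(`ringKrullDim_quotient_add_one_le_of_lt`), and each is covered by ONE Noether chart with `d - 1`
parameters (`exists_chart`, from Mathlib's `exists_integral_inj_algHom_of_quotient` and
`dim = number of Noether parameters`).  If some top prime is good this is the decomposition
(`exists_decomposition_of_good`); otherwise all rational points lie on the exceptional ideals
(`eq_of_bad`) and the induction hypothesis applies.

## References

* S. Lang, A. Weil, Number of points of varieties in finite fields, Amer. J. Math. 76 (1954)
  819–827, §2 (reduction to hypersurfaces). [LangWeil1954]
* R. Hartshorne, *Algebraic Geometry*, GTM 52 (1977), Ch. I Prop. 4.9. [Hartshorne1977]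
* H. Matsumura, *Commutative Ring Theory* (1986), Thm. 5.6, §33 Lemma 2. [Matsumura1987]
* Z. Chatzidakis, L. van den Dries, A. Macintyre, Definable sets over finite fields, J. reine
  angew. Math. 427 (1992) 107–135, Prop. 3.3. [ChatzidakisVanDenDriesMacintyre1992]
-/

noncomputable section

open MvPolynomial
open scoped Polynomial

namespace Literature.NumberTheory.DiophantineGeometry

open Literature.RingTheory.NoetherNormalization

variable {K : Type*} [Field K] {n : ℕ}

/-! ### Rational points of ideals -/

/-- The set of `K`-rational zeros of an ideal `J ⊆ K[X₁, …, Xₙ]`. [folklore] -/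
def ratPoints (J : Ideal (MvPolynomial (Fin n) K)) : Set (Fin n → K) :=
  {x | ∀ g ∈ J, eval x g = 0}

/-- A point is a rational zero of `J` iff `J` is contained in the kernel of the evaluation. [folklore] -/
theorem mem_ratPoints_iff {J : Ideal (MvPolynomial (Fin n) K)} {x : Fin n → K} :
    x ∈ ratPoints J ↔ J ≤ RingHom.ker (eval x) := by
  simp only [ratPoints, Set.mem_setOf_eq, SetLike.le_def, RingHom.mem_ker]

/-- Larger ideals have fewer rational points. [folklore] -/
theorem ratPoints_mono {I J : Ideal (MvPolynomial (Fin n) K)} (h : I ≤ J) :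
    ratPoints J ⊆ ratPoints I := fun _ hx g hg => hx g (h hg)

/-- The unit ideal has no rational points. [folklore] -/
theorem ratPoints_top : ratPoints (⊤ : Ideal (MvPolynomial (Fin n) K)) = ∅ := by
  ext x
  simp only [Set.mem_empty_iff_false, iff_false]
  intro hx
  have h := hx 1 Submodule.mem_top
  rw [map_one] at h
  exact one_ne_zero h

/-- Rational points of a sum of ideals. [folklore] -/
theorem mem_ratPoints_sup_iff {I J : Ideal (MvPolynomial (Fin n) K)} {x : Fin n → K} :
    x ∈ ratPoints (I ⊔ J) ↔ x ∈ ratPoints I ∧ x ∈ ratPoints J := by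
  simp only [mem_ratPoints_iff, sup_le_iff]

/-- Rational points of `I + (g)`. [folklore] -/
theorem mem_ratPoints_sup_span_singleton_iff {I : Ideal (MvPolynomial (Fin n) K)}
    {g : MvPolynomial (Fin n) K} {x : Fin n → K} :
    x ∈ ratPoints (I ⊔ Ideal.span {g}) ↔ x ∈ ratPoints I ∧ eval x g = 0 := by
  rw [mem_ratPoints_sup_iff, mem_ratPoints_iff (J := Ideal.span {g}), Ideal.span_singleton_le_iff_mem,
    RingHom.mem_ker]

/-- The rational points of `J` are those of its minimal primes. [folklore] -/
theorem mem_ratPoints_iff_exists_minimalPrimes {J : Ideal (MvPolynomial (Fin n) K)}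
    {x : Fin n → K} : x ∈ ratPoints J ↔ ∃ P ∈ J.minimalPrimes, x ∈ ratPoints P := by
  constructor
  · intro hx
    rw [mem_ratPoints_iff] at hx
    haveI : (RingHom.ker (eval x : MvPolynomial (Fin n) K →+* K)).IsPrime := RingHom.ker_isPrime _
    obtain ⟨P, hP, hPx⟩ := Ideal.exists_minimalPrimes_le hx
    exact ⟨P, hP, mem_ratPoints_iff.mpr hPx⟩
  · rintro ⟨P, hP, hx⟩
    exact ratPoints_mono hP.1.2 hx

/-! ### Dimension bookkeeping -/

/-- The dimension of `K[X₁, …, Xₙ]/P` for a prime `P` is a natural number `≤ n`.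
[cite: Matsumura1987, Thm 5.6] -/
theorem exists_nat_ringKrullDim_quotient_eq (P : Ideal (MvPolynomial (Fin n) K)) [P.IsPrime] :
    ∃ d : ℕ, ringKrullDim (MvPolynomial (Fin n) K ⧸ P) = d ∧ d ≤ n := by
  obtain ⟨s, hs, -⟩ := Literature.RingTheory.KrullDimension.exists_ringKrullDim_eq_and_trdeg_eq K
    (MvPolynomial (Fin n) K ⧸ P)
  refine ⟨s, hs, ?_⟩
  have h := ringKrullDim_le_of_surjective (Ideal.Quotient.mk P) Ideal.Quotient.mk_surjective
  rw [hs, MvPolynomial.ringKrullDim_of_isNoetherianRing, ringKrullDim_eq_zero_of_field,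
    Nat.card_eq_fintype_card, Fintype.card_fin, zero_add] at h
  exact_mod_cast h

/-- Passing to a strictly larger ideal than a prime drops the dimension.  (A Summits-side file
proves the same statement; Literature cannot import Summits, so it is proved here from the tree's
`ringKrullDim_quotient_add_one_le`.) [folklore] -/
theorem ringKrullDim_quotient_add_one_le_of_lt {R : Type*} [CommRing R] {P I : Ideal R}
    [P.IsPrime] (h : P < I) : ringKrullDim (R ⧸ I) + 1 ≤ ringKrullDim (R ⧸ P) := by
  have hne : I.map (Ideal.Quotient.mk P) ≠ ⊥ := by
    intro hbot
    apply not_le_of_gt h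
    intro g hg
    have hmem : Ideal.Quotient.mk P g ∈ I.map (Ideal.Quotient.mk P) := Ideal.mem_map_of_mem _ hg
    rw [hbot, Ideal.mem_bot, Ideal.Quotient.eq_zero_iff_mem] at hmem
    exact hmem
  have h1 := Literature.RingTheory.KrullDimension.ringKrullDim_quotient_add_one_le hne
  rwa [ringKrullDim_eq_of_ringEquiv (DoubleQuot.quotQuotEquivQuotOfLE h.le)] at h1

/-- An ideal of "dimension `< 0`" is the unit ideal. [folklore] -/
theorem eq_top_of_ringKrullDim_add_one_le_zero {R : Type*} [CommRing R] {I : Ideal R}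
    (h : ringKrullDim (R ⧸ I) + 1 ≤ 0) : I = ⊤ := by
  by_contra hI
  haveI : Nontrivial (R ⧸ I) := Ideal.Quotient.nontrivial_iff.mpr hI
  have h0 := ringKrullDim_nonneg_of_nontrivial (R := R ⧸ I)
  have h1 : (0 : WithBot ℕ∞) + 1 ≤ 0 := le_trans (add_le_add h0 le_rfl) h
  have h2 : ((1 : ℕ) : WithBot ℕ∞) ≤ (0 : ℕ) := by simpa using h1
  have h3 : (1 : ℕ) ≤ 0 := by exact_mod_cast h2
  omega

/-- Two distinct primes of the same finite dimension are incomparable: `P < P ⊔ P'`. [folklore] -/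
theorem lt_sup_of_ringKrullDim_eq {R : Type*} [CommRing R] {P P' : Ideal R} [P.IsPrime]
    [P'.IsPrime] {d : ℕ} (hP : ringKrullDim (R ⧸ P) = d) (hP' : ringKrullDim (R ⧸ P') = d)
    (hne : P ≠ P') : P < P ⊔ P' := by
  refine lt_of_le_of_ne le_sup_left fun heq => ?_
  have hle : P' ≤ P := by rw [heq]; exact le_sup_right
  have hlt : P' < P := lt_of_le_of_ne hle (Ne.symm hne)
  have h := ringKrullDim_quotient_add_one_le_of_lt hlt
  rw [hP, hP'] at h
  have h' : d + 1 ≤ d := by exact_mod_cast h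
  omega

/-! ### `∂/∂X₀` and `finSuccEquiv` -/

/-- `finSuccEquiv` turns the partial derivative in the distinguished variable into the
derivative of the univariate polynomial.  (Same statement as
`Literature.Combinatorics.StablePolynomials.finSuccEquiv_pderiv_zero` in
`GurvitsCapacityBound.lean`; restated here in 15 lines rather than importing the stable-polynomial
closure, which starts with `import Mathlib`, into this topic.) [folklore] -/
theorem finSuccEquiv_pderiv_zero {R : Type*} [CommRing R] {d : ℕ}
    (f : MvPolynomial (Fin (d + 1)) R) :
    finSuccEquiv R d (pderiv 0 f) = Polynomial.derivative (finSuccEquiv R d f) := by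
  induction f using MvPolynomial.induction_on with
  | C a =>
    rw [pderiv_C, map_zero, ← MvPolynomial.algebraMap_eq, AlgEquiv.commutes,
      Polynomial.algebraMap_apply, Polynomial.derivative_C]
  | add p q hp hq => rw [map_add, map_add, map_add, hp, hq, Polynomial.derivative_add]
  | mul_X p i hp =>
    have hX : finSuccEquiv R d (pderiv 0 (X i)) = Polynomial.derivative (finSuccEquiv R d (X i)) := by
      refine Fin.cases ?_ (fun j => ?_) i
      · rw [pderiv_X_self, map_one, finSuccEquiv_X_zero, Polynomial.derivative_X]
      · rw [pderiv_X_of_ne (Fin.succ_ne_zero j), map_zero, finSuccEquiv_X_succ,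
          Polynomial.derivative_C]
    rw [Derivation.leibniz, smul_eq_mul, smul_eq_mul, map_add, map_mul, map_mul, hp, hX, map_mul,
      Polynomial.derivative_mul]
    ring

/-- Evaluating `∂f/∂X₀` at `(v, y)` is evaluating the `T`-derivative of `f(y; T)` at `v`.
[folklore] -/
theorem eval_cons_pderiv_zero {d : ℕ} (f : MvPolynomial (Fin (d + 1)) K) (y : Fin d → K) (v : K) :
    eval (Fin.cons v y : Fin (d + 1) → K) (pderiv 0 f) =
      ((Polynomial.derivative (finSuccEquiv K d f)).map (eval y)).eval v := by
  rw [eval_eq_eval_mv_eval', finSuccEquiv_pderiv_zero]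

/-- Evaluating `(finSuccEquiv K d).symm q` at `(v, y)`. [folklore] -/
theorem eval_cons_finSuccEquiv_symm {d : ℕ} (q : (MvPolynomial (Fin d) K)[X]) (y : Fin d → K)
    (v : K) : eval (Fin.cons v y : Fin (d + 1) → K) ((finSuccEquiv K d).symm q) =
      (q.map (eval y)).eval v := by
  rw [eval_eq_eval_mv_eval', AlgEquiv.apply_symm_apply]

/-- Evaluating the substitution `q(X∘emb, U)` at a point. [folklore] -/
theorem eval_subst {d : ℕ} (emb : Fin d ↪ Fin n) (U : MvPolynomial (Fin n) K)
    (q : (MvPolynomial (Fin d) K)[X]) (x : Fin n → K) :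
    eval x (subst emb U q) = (q.map (eval (x ∘ emb))).eval (eval x U) := by
  unfold subst
  rw [Polynomial.hom_eval₂, Polynomial.eval_map]
  congr 1
  refine RingHom.ext fun p => ?_
  simp only [RingHom.coe_comp, Function.comp_apply, AlgHom.toRingHom_eq_coe, AlgHom.coe_toRingHom,
    eval_rename]

/-! ### Shapes: pieces, charts -/

section Shapes

variable (K n)

/-- A (candidate) good piece in dimension `d`: parameters `T : Kⁿ → K^d`, a primitive
coordinate `U`, the hypersurface equation `m ∈ K[X₀, X₁, …, X_d]` (`X₀` = the primitive
variable), the denominator `δ ∈ K[X₁..X_d]` and the numerators `w_j`. [folklore] -/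
structure Piece (d : ℕ) where
  /-- the parameters -/
  T : Fin d → MvPolynomial (Fin n) K
  /-- the primitive coordinate -/
  U : MvPolynomial (Fin n) K
  /-- the hypersurface equation, variable `0` distinguished -/
  m : MvPolynomial (Fin (d + 1)) K
  /-- the denominator -/
  δ : MvPolynomial (Fin d) K
  /-- the numerators -/
  w : Fin n → MvPolynomial (Fin (d + 1)) K

/-- A Noether chart with `d'` parameters: `T : Kⁿ → K^{d'}` and, for each coordinate `j`, an
equation `N_j ∈ K[X₀, X₁, …, X_{d'}]` monic in `X₀`. [folklore] -/
structure Chart (d' : ℕ) where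
  /-- the parameters -/
  T : Fin d' → MvPolynomial (Fin n) K
  /-- the integral equations of the coordinates -/
  N : Fin n → MvPolynomial (Fin (d' + 1)) K

variable {K n}

/-- `m` is monic of degree `k` in the distinguished variable `X₀`. [folklore] -/
def MonicIn0 {d : ℕ} (m : MvPolynomial (Fin (d + 1)) K) (k : ℕ) : Prop :=
  (finSuccEquiv K d m).Monic ∧ (finSuccEquiv K d m).natDegree = k

namespace Piece

variable {d : ℕ} (p : Piece K n d)

/-- The parameters `y = T(x)` of a point. [folklore] -/
def par (x : Fin n → K) : Fin d → K := fun k => eval x (p.T k)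

/-- The lifted point `(U(x), T(x)) ∈ K^{1+d}`. [folklore] -/
def lift (x : Fin n → K) : Fin (d + 1) → K := Fin.cons (eval x p.U) (p.par x)

/-- Membership in the piece `Z°`: `δ(Tx) ≠ 0`, `m(Ux, Tx) = 0`, `δ(Tx) x_j = w_j(Ux, Tx)`. [folklore] -/
def Mem (x : Fin n → K) : Prop :=
  eval (p.par x) p.δ ≠ 0 ∧ eval (p.lift x) p.m = 0 ∧
    ∀ j, eval (p.par x) p.δ * x j = eval (p.lift x) (p.w j)

/-- The parametrisation property (d): a point `x` with `δ(y) x = w(v, y)` for a zero `(v, y)` of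
`m` with `δ(y) ≠ 0` has parameters `T(x) = y` and `U(x) = v`. [folklore] -/
def Param : Prop :=
  ∀ (y : Fin d → K) (v : K) (x : Fin n → K), eval (Fin.cons v y : Fin (d + 1) → K) p.m = 0 →
    eval y p.δ ≠ 0 → (∀ j, eval y p.δ * x j = eval (Fin.cons v y : Fin (d + 1) → K) (p.w j)) →
      p.par x = y ∧ eval x p.U = v

/-- All the polynomials of the piece have total degree `≤ B`. [folklore] -/
def DegLE (B : ℕ) : Prop :=
  (∀ k, (p.T k).totalDegree ≤ B) ∧ p.U.totalDegree ≤ B ∧ p.m.totalDegree ≤ B ∧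
    p.δ.totalDegree ≤ B ∧ ∀ j, (p.w j).totalDegree ≤ B

/-- A degree bound for the piece. [folklore] -/
def deg : ℕ :=
  (Finset.univ.sup fun k => (p.T k).totalDegree) ⊔ p.U.totalDegree ⊔ p.m.totalDegree ⊔
    p.δ.totalDegree ⊔ Finset.univ.sup fun j => (p.w j).totalDegree

/-- The degree bound `deg` controls `DegLE`. [folklore] -/
theorem degLE_of_deg_le {B : ℕ} (h : p.deg ≤ B) : p.DegLE B := by
  simp only [deg, sup_le_iff, Finset.sup_le_iff, Finset.mem_univ, forall_const] at h
  exact ⟨h.1.1.1.1, h.1.1.1.2, h.1.1.2, h.1.2, h.2⟩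

end Piece

namespace Chart

variable {d' : ℕ} (c : Chart K n d')

/-- The parameters of a point. [folklore] -/
def par (x : Fin n → K) : Fin d' → K := fun k => eval x (c.T k)

/-- Membership in the chart: every coordinate satisfies its equation over the parameters. [folklore] -/
def Mem (x : Fin n → K) : Prop :=
  ∀ j, eval (Fin.cons (x j) (c.par x) : Fin (d' + 1) → K) (c.N j) = 0

/-- Degree bound. [folklore] -/
def DegLE (B : ℕ) : Prop := (∀ k, (c.T k).totalDegree ≤ B) ∧ ∀ j, (c.N j).totalDegree ≤ B

/-- A degree bound for the chart. [folklore] -/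
def deg : ℕ := (Finset.univ.sup fun k => (c.T k).totalDegree) ⊔ Finset.univ.sup fun j => (c.N j).totalDegree

/-- The degree bound `deg` controls `DegLE`. [folklore] -/
theorem degLE_of_deg_le {B : ℕ} (h : c.deg ≤ B) : c.DegLE B := by
  simp only [deg, sup_le_iff, Finset.sup_le_iff, Finset.mem_univ, forall_const] at h
  exact ⟨h.1, h.2⟩

end Chart

variable (K n)

/-- **A rational-trace decomposition** of a set `V ⊆ Kⁿ` with complexity `≤ B`: a dimension
`d ≤ n`, `μ ∈ [1, B]` good pieces and `L ≤ B` Noether charts with `d - 1` parameters (none if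
`d = 0`), all polynomials of degree `≤ B`, each `m_i` monic in `X₀` and absolutely irreducible,
`δ_i ≠ 0`, the chart equations monic in `X₀`, such that (a) the pieces lie in `V`, (b) `V` is
covered by the pieces and the charts, (c) two distinct pieces only meet inside the charts, and
(d) each piece is parametrised by `{m_i = 0, δ_i ≠ 0} ⊆ K^{1+d}`. [folklore] -/
structure Decomposition (V : Set (Fin n → K)) (B : ℕ) where
  /-- the dimension -/
  d : ℕ
  /-- the number of good pieces -/
  μ : ℕ
  /-- the good pieces -/
  piece : Fin μ → Piece K n d
  /-- the number of charts -/
  L : ℕ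
  /-- the charts -/
  chart : Fin L → Chart K n (d - 1)
  d_le : d ≤ n
  one_le_μ : 1 ≤ μ
  μ_le : μ ≤ B
  L_le : L ≤ B
  L_eq_zero : d = 0 → L = 0
  piece_degLE : ∀ i, (piece i).DegLE B
  chart_degLE : ∀ l, (chart l).DegLE B
  piece_monic : ∀ i, ∃ k, 1 ≤ k ∧ MonicIn0 (piece i).m k
  chart_monic : ∀ l j, ∃ k, 1 ≤ k ∧ MonicIn0 ((chart l).N j) k
  isAbsIrreducible : ∀ i, IsAbsIrreducible (piece i).m
  δ_ne_zero : ∀ i, (piece i).δ ≠ 0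
  subset : ∀ i x, (piece i).Mem x → x ∈ V
  cover : ∀ x ∈ V, (∃ l, (chart l).Mem x) ∨ ∃ i, (piece i).Mem x
  overlap : ∀ i i' x, i ≠ i' → (piece i).Mem x → (piece i').Mem x → ∃ l, (chart l).Mem x
  param : ∀ i, (piece i).Param

variable {K n}

/-- Monotonicity of the degree bound of a piece. [folklore] -/
theorem Piece.DegLE.mono {d : ℕ} {p : Piece K n d} {B B' : ℕ} (h : p.DegLE B) (hB : B ≤ B') :
    p.DegLE B' :=
  ⟨fun k => (h.1 k).trans hB, h.2.1.trans hB, h.2.2.1.trans hB, h.2.2.2.1.trans hB,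
    fun j => (h.2.2.2.2 j).trans hB⟩

/-- Monotonicity of the degree bound of a chart. [folklore] -/
theorem Chart.DegLE.mono {d' : ℕ} {c : Chart K n d'} {B B' : ℕ} (h : c.DegLE B) (hB : B ≤ B') :
    c.DegLE B' :=
  ⟨fun k => (h.1 k).trans hB, fun j => (h.2 j).trans hB⟩

/-- A decomposition of complexity `≤ B` has complexity `≤ B'` for `B ≤ B'`. [folklore] -/
def Decomposition.mono {V : Set (Fin n → K)} {B B' : ℕ} (𝒟 : Decomposition K n V B)
    (hB : B ≤ B') : Decomposition K n V B' :=
  { 𝒟 with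
    μ_le := 𝒟.μ_le.trans hB
    L_le := 𝒟.L_le.trans hB
    piece_degLE := fun i => (𝒟.piece_degLE i).mono hB
    chart_degLE := fun l => (𝒟.chart_degLE l).mono hB }

/-- Assembling a decomposition from finitely indexed data. [folklore] -/
theorem Decomposition.exists_of_fintype {V : Set (Fin n → K)} {d : ℕ} (hd : d ≤ n)
    {ι κ : Type*} [Fintype ι] [Fintype κ] [Nonempty ι] (piece : ι → Piece K n d)
    (W : Set (Fin n → K)) (chart : κ → Chart K n (d - 1))
    (hW : ∀ x ∈ W, ∃ l, (chart l).Mem x) (hκ : d = 0 → IsEmpty κ)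
    (hmonic : ∀ i, ∃ k, 1 ≤ k ∧ MonicIn0 (piece i).m k)
    (hcmonic : ∀ l j, ∃ k, 1 ≤ k ∧ MonicIn0 ((chart l).N j) k)
    (habs : ∀ i, IsAbsIrreducible (piece i).m) (hδ : ∀ i, (piece i).δ ≠ 0)
    (ha : ∀ i x, (piece i).Mem x → x ∈ V) (hb : ∀ x ∈ V, x ∈ W ∨ ∃ i, (piece i).Mem x)
    (hc : ∀ i i' x, i ≠ i' → (piece i).Mem x → (piece i').Mem x → x ∈ W)
    (hparam : ∀ i, (piece i).Param) :
    ∃ B, Nonempty (Decomposition K n V B) := by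
  classical
  set B : ℕ := Fintype.card ι ⊔ Fintype.card κ ⊔ (Finset.univ.sup fun i => (piece i).deg) ⊔
    Finset.univ.sup fun l => (chart l).deg with hB
  have hBι : Fintype.card ι ≤ B := by simp [hB]
  have hBκ : Fintype.card κ ≤ B := by simp [hB]
  have hBp : ∀ i, (piece i).deg ≤ B := fun i => by
    have : (piece i).deg ≤ Finset.univ.sup fun i => (piece i).deg :=
      Finset.le_sup (f := fun i => (piece i).deg) (Finset.mem_univ i)
    simp only [hB]; omega
  have hBc : ∀ l, (chart l).deg ≤ B := fun l => by
    have : (chart l).deg ≤ Finset.univ.sup fun l => (chart l).deg :=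
      Finset.le_sup (f := fun l => (chart l).deg) (Finset.mem_univ l)
    simp only [hB]; omega
  let eι := Fintype.equivFin ι
  let eκ := Fintype.equivFin κ
  refine ⟨B, ⟨{
    d := d
    μ := Fintype.card ι
    piece := fun i => piece (eι.symm i)
    L := Fintype.card κ
    chart := fun l => chart (eκ.symm l)
    d_le := hd
    one_le_μ := Fintype.card_pos
    μ_le := hBι
    L_le := hBκ
    L_eq_zero := fun h0 => by haveI := hκ h0; exact Fintype.card_eq_zero
    piece_degLE := fun i => (piece _).degLE_of_deg_le (hBp _)
    chart_degLE := fun l => (chart _).degLE_of_deg_le (hBc _)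
    piece_monic := fun i => hmonic _
    chart_monic := fun l j => hcmonic _ j
    isAbsIrreducible := fun i => habs _
    δ_ne_zero := fun i => hδ _
    subset := fun i x hx => ha _ x hx
    cover := fun x hx => ?_
    overlap := fun i i' x hii' hi hi' => ?_
    param := fun i => hparam _ }⟩⟩
  · rcases hb x hx with hxW | ⟨i, hi⟩
    · obtain ⟨l, hl⟩ := hW x hxW
      exact Or.inl ⟨eκ l, by simpa using hl⟩
    · exact Or.inr ⟨eι i, by simpa using hi⟩
  · have hne : eι.symm i ≠ eι.symm i' := fun h => hii' (eι.symm.injective h)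
    obtain ⟨l, hl⟩ := hW x (hc _ _ x hne hi hi')
    exact ⟨eκ l, by simpa using hl⟩

end Shapes


/-! ### Hypersurface-model data at a prescribed dimension -/

/-- The data of `HypersurfaceModel P` with the dimension `d` as a parameter (and the Bézout
identity as an existence statement). [cite: Hartshorne1977, Ch. I Prop. 4.9] -/
structure ModelData (P : Ideal (MvPolynomial (Fin n) K)) (d : ℕ) where
  /-- the coordinates forming a separating transcendence basis -/
  emb : Fin d ↪ Fin n
  /-- a lift of the primitive element -/
  U : MvPolynomial (Fin n) K
  /-- the minimal polynomial of the primitive element over `K[Y]` -/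
  m : (MvPolynomial (Fin d) K)[X]
  /-- the common denominator -/
  δ : MvPolynomial (Fin d) K
  /-- the Bézout element -/
  ρ : MvPolynomial (Fin d) K
  /-- the numerators -/
  w : Fin n → (MvPolynomial (Fin d) K)[X]
  dim_eq : ringKrullDim (MvPolynomial (Fin n) K ⧸ P) = d
  monic : m.Monic
  natDegree_pos : 0 < m.natDegree
  irreducible : Irreducible m
  δ_ne_zero : δ ≠ 0
  ρ_ne_zero : ρ ≠ 0
  bezout : ∃ a b : (MvPolynomial (Fin d) K)[X], a * m + b * Polynomial.derivative m = Polynomial.C ρ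
  eq_zero_of_rename_mem : ∀ q : MvPolynomial (Fin d) K, rename emb q ∈ P → q = 0
  subst_m_mem : subst emb U m ∈ P
  graph_mem : ∀ j, rename emb δ * X j - subst emb U (w j) ∈ P
  point_spec : ∀ (y : Fin d → K) (v : K), (m.map (eval y)).eval v = 0 → eval y δ ≠ 0 →
    (∀ g ∈ P, eval (pt δ w y v) g = 0) ∧ eval (pt δ w y v) U = v ∧ ∀ k, pt δ w y v (emb k) = y k

/-- Model data exist in the dimension of `P` (from `HypersurfaceModel.nonempty`).
[cite: Hartshorne1977, Ch. I Prop. 4.9] -/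
theorem ModelData.nonempty [PerfectField K] (P : Ideal (MvPolynomial (Fin n) K)) [P.IsPrime]
    {d : ℕ} (hd : ringKrullDim (MvPolynomial (Fin n) K ⧸ P) = d) : Nonempty (ModelData P d) := by
  obtain ⟨H⟩ := HypersurfaceModel.nonempty P
  obtain ⟨d', emb, U, m, δ, ρ, w, a, b, hdim, h1, h2, h3, h4, h5, h6, h7, h8, h9, h10⟩ := H
  have hdd : d' = d := by
    rw [hdim] at hd
    exact_mod_cast hd
  subst hdd
  exact ⟨⟨emb, U, m, δ, ρ, w, hdim, h1, h2, h3, h4, h5, ⟨a, b, h6⟩, h7, h8, h9, h10⟩⟩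

namespace ModelData

variable {P : Ideal (MvPolynomial (Fin n) K)} {d : ℕ} (D : ModelData P d)

/-- The good piece of the model: parameters = the chosen coordinates. [folklore] -/
def piece : Piece K n d where
  T := fun k => X (D.emb k)
  U := D.U
  m := (finSuccEquiv K d).symm D.m
  δ := D.δ
  w := fun j => (finSuccEquiv K d).symm (D.w j)

/-- The parameters of the model piece are the chosen coordinates. [folklore] -/
@[simp] theorem piece_T (k : Fin d) : D.piece.T k = X (D.emb k) := rfl
/-- The primitive coordinate of the model piece. [folklore] -/
@[simp] theorem piece_U : D.piece.U = D.U := rfl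
/-- The equation of the model piece. [folklore] -/
@[simp] theorem piece_m : D.piece.m = (finSuccEquiv K d).symm D.m := rfl
/-- The denominator of the model piece. [folklore] -/
@[simp] theorem piece_δ : D.piece.δ = D.δ := rfl
/-- The numerators of the model piece. [folklore] -/
@[simp] theorem piece_w (j : Fin n) : D.piece.w j = (finSuccEquiv K d).symm (D.w j) := rfl

/-- The parameters of a point in the model piece are its chosen coordinates. [folklore] -/
@[simp] theorem piece_par (x : Fin n → K) : D.piece.par x = x ∘ D.emb :=
  funext fun _ => eval_X _

/-- Membership in the model piece, unfolded. [folklore] -/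
theorem piece_mem_iff (x : Fin n → K) : D.piece.Mem x ↔
    eval (x ∘ D.emb) D.δ ≠ 0 ∧ (D.m.map (eval (x ∘ D.emb))).eval (eval x D.U) = 0 ∧
      ∀ j, eval (x ∘ D.emb) D.δ * x j = ((D.w j).map (eval (x ∘ D.emb))).eval (eval x D.U) := by
  simp only [Piece.Mem, Piece.lift, piece_par, piece_δ, piece_m, piece_U, piece_w,
    eval_cons_finSuccEquiv_symm]

/-- The equation of the model piece is monic in `X₀` of degree `deg m`. [folklore] -/
theorem piece_monicIn0 : MonicIn0 D.piece.m D.m.natDegree := by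
  unfold MonicIn0
  rw [piece_m, AlgEquiv.apply_symm_apply]
  exact ⟨D.monic, rfl⟩

/-- A point satisfying the graph equations is the parametrised point `pt`. [folklore] -/
theorem eq_pt (y : Fin d → K) (v : K) (x : Fin n → K) (hδ : eval y D.δ ≠ 0)
    (hx : ∀ j, eval y D.δ * x j = ((D.w j).map (eval y)).eval v) : x = pt D.δ D.w y v := by
  funext j
  unfold pt
  rw [eq_div_iff hδ, mul_comm]
  exact hx j

/-- (a) The piece consists of points of `V(P)`. [folklore] -/
theorem mem_ratPoints_of_piece_mem {x : Fin n → K} (hx : D.piece.Mem x) : x ∈ ratPoints P := by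
  rw [piece_mem_iff] at hx
  obtain ⟨hδ, hm, hw⟩ := hx
  have hxeq := D.eq_pt (x ∘ D.emb) (eval x D.U) x hδ hw
  intro g hg
  have h := (D.point_spec (x ∘ D.emb) (eval x D.U) hm hδ).1 g hg
  rwa [← hxeq] at h

/-- (d) The parametrisation property of the piece. [folklore] -/
theorem piece_param : D.piece.Param := by
  intro y v x hm hδ hw
  simp only [piece_m, piece_δ, piece_w, eval_cons_finSuccEquiv_symm] at hm hδ hw
  have hxeq := D.eq_pt y v x hδ hw
  have h := D.point_spec y v hm hδ
  refine ⟨?_, ?_⟩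
  · rw [piece_par]
    funext k
    rw [Function.comp_apply, hxeq]
    exact h.2.2 k
  · rw [piece_U, hxeq]
    exact h.2.1

/-- Points of `V(P)` off `δ = 0` are in the piece. [folklore] -/
theorem piece_mem_of_mem_ratPoints {x : Fin n → K} (hx : x ∈ ratPoints P)
    (hδ : eval (x ∘ D.emb) D.δ ≠ 0) : D.piece.Mem x := by
  rw [piece_mem_iff]
  refine ⟨hδ, ?_, fun j => ?_⟩
  · have h := hx _ D.subst_m_mem
    rwa [eval_subst] at h
  · have h := hx _ (D.graph_mem j)
    rw [map_sub, map_mul, eval_rename, eval_X, eval_subst] at h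
    exact sub_eq_zero.mp h

/-- On a BAD model (minimal polynomial not absolutely irreducible) every rational point of
`V(P)` has `ρ(y) = 0`: all rational zeros of `m` are singular
(`eval_pderiv_eq_zero_of_irreducible_of_not_isAbsIrreducible`) and `a m + b ∂_T m = ρ`.
[folklore] -/
theorem eval_rho_eq_zero [PerfectField K] (hbad : ¬ IsAbsIrreducible D.piece.m)
    {x : Fin n → K} (hx : x ∈ ratPoints P) : eval (x ∘ D.emb) D.ρ = 0 := by
  have hm : (D.m.map (eval (x ∘ D.emb))).eval (eval x D.U) = 0 := by
    have h := hx _ D.subst_m_mem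
    rwa [eval_subst] at h
  have hirr : Irreducible D.piece.m :=
    (MulEquiv.irreducible_iff (finSuccEquiv K d).symm.toMulEquiv).mpr D.irreducible
  have hzero : eval (Fin.cons (eval x D.U) (x ∘ D.emb) : Fin (d + 1) → K) D.piece.m = 0 := by
    rw [piece_m, eval_cons_finSuccEquiv_symm]
    exact hm
  have hder := eval_pderiv_eq_zero_of_irreducible_of_not_isAbsIrreducible hirr hbad hzero 0
  rw [eval_cons_pderiv_zero, piece_m, AlgEquiv.apply_symm_apply] at hder
  obtain ⟨a, b, hab⟩ := D.bezout
  have h := congrArg (fun q => (q.map (eval (x ∘ D.emb))).eval (eval x D.U)) hab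
  simp only [Polynomial.map_add, Polynomial.map_mul, Polynomial.eval_add, Polynomial.eval_mul,
    Polynomial.map_C, Polynomial.eval_C] at h
  rw [hm, hder, mul_zero, mul_zero, add_zero] at h
  exact h.symm

/-- The exceptional ideal `P + (δρ)(X∘emb)` of the model. [folklore] -/
def exc : Ideal (MvPolynomial (Fin n) K) := P ⊔ Ideal.span {rename D.emb (D.δ * D.ρ)}

/-- The exceptional ideal strictly contains `P` (`δρ ∉ P` along the algebraically independent coordinates). [folklore] -/
theorem lt_exc : P < D.exc := by
  refine lt_of_le_of_ne le_sup_left fun heq => ?_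
  have hle : D.exc ≤ P := le_of_eq heq.symm
  have hmem : rename D.emb (D.δ * D.ρ) ∈ P := hle (Ideal.mem_sup_right (Ideal.subset_span rfl))
  exact mul_ne_zero D.δ_ne_zero D.ρ_ne_zero (D.eq_zero_of_rename_mem _ hmem)

/-- The exceptional ideal has dimension `< d`. [folklore] -/
theorem ringKrullDim_exc [P.IsPrime] : ringKrullDim (MvPolynomial (Fin n) K ⧸ D.exc) + 1 ≤ d := by
  have h := ringKrullDim_quotient_add_one_le_of_lt D.lt_exc
  rwa [D.dim_eq] at h

/-- Rational points of the exceptional ideal. [folklore] -/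
theorem mem_ratPoints_exc_iff {x : Fin n → K} : x ∈ ratPoints D.exc ↔
    x ∈ ratPoints P ∧ eval (x ∘ D.emb) D.δ * eval (x ∘ D.emb) D.ρ = 0 := by
  rw [exc, mem_ratPoints_sup_span_singleton_iff, eval_rename, map_mul]

/-- Every rational point of `V(P)` is in the piece or in the exceptional set. [folklore] -/
theorem piece_mem_or_mem_exc {x : Fin n → K} (hx : x ∈ ratPoints P) :
    D.piece.Mem x ∨ x ∈ ratPoints D.exc := by
  by_cases hδ : eval (x ∘ D.emb) D.δ = 0
  · right
    rw [mem_ratPoints_exc_iff, hδ, zero_mul]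
    exact ⟨hx, rfl⟩
  · exact Or.inl (D.piece_mem_of_mem_ratPoints hx hδ)

/-- On a bad model every rational point is exceptional. [folklore] -/
theorem mem_exc_of_bad [PerfectField K] (hbad : ¬ IsAbsIrreducible D.piece.m) {x : Fin n → K}
    (hx : x ∈ ratPoints P) : x ∈ ratPoints D.exc := by
  rw [mem_ratPoints_exc_iff, D.eval_rho_eq_zero hbad hx, mul_zero]
  exact ⟨hx, rfl⟩

/-- The piece lies in `V(P)`, hence two pieces meet only on `V(P ⊔ P')`. [folklore] -/
theorem mem_ratPoints_sup_of_piece_mem {P' : Ideal (MvPolynomial (Fin n) K)} {d' : ℕ}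
    (D' : ModelData P' d') {x : Fin n → K} (hx : D.piece.Mem x) (hx' : D'.piece.Mem x) :
    x ∈ ratPoints (P ⊔ P') :=
  mem_ratPoints_sup_iff.mpr ⟨D.mem_ratPoints_of_piece_mem hx, D'.mem_ratPoints_of_piece_mem hx'⟩

end ModelData

/-! ### Noether charts -/

/-- **Noether cover.** An ideal `E` with `dim K[X]/E ≤ d'` (or `E = ⊤`) admits a chart with `d'`
parameters containing all its rational points: Noether normalisation
(`exists_integral_inj_algHom_of_quotient`) makes every coordinate integral over `d' ≥ dim`
parameters. [cite: Matsumura1987, Thm 5.6] -/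
theorem exists_chart (E : Ideal (MvPolynomial (Fin n) K)) {d' : ℕ}
    (hE : ringKrullDim (MvPolynomial (Fin n) K ⧸ E) + 1 ≤ (d' + 1 : ℕ)) :
    ∃ c : Chart K n d', (∀ x ∈ ratPoints E, c.Mem x) ∧ ∀ j, ∃ k, 1 ≤ k ∧ MonicIn0 (c.N j) k := by
  classical
  by_cases hEtop : E = ⊤
  · subst hEtop
    refine ⟨⟨0, fun _ => X 0⟩, fun x hx => ?_, fun j => ⟨1, le_rfl, ?_⟩⟩
    · rw [ratPoints_top] at hx
      exact absurd hx (Set.notMem_empty x)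
    · refine ⟨?_, ?_⟩
      · simp only [finSuccEquiv_X_zero]; exact Polynomial.monic_X
      · simp only [finSuccEquiv_X_zero, Polynomial.natDegree_X]
  obtain ⟨s, -, g, hginj, hgint⟩ := exists_integral_inj_algHom_of_quotient E hEtop
  -- `s = dim ≤ d'`
  have hs : s ≤ d' := by
    letI alg : Algebra (MvPolynomial (Fin s) K) (MvPolynomial (Fin n) K ⧸ E) := g.toRingHom.toAlgebra
    haveI : Algebra.IsIntegral (MvPolynomial (Fin s) K) (MvPolynomial (Fin n) K ⧸ E) :=
      ⟨fun a => hgint a⟩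
    have hinj' : Function.Injective
        (algebraMap (MvPolynomial (Fin s) K) (MvPolynomial (Fin n) K ⧸ E)) := hginj
    have hdim := Literature.RingTheory.KrullDimension.ringKrullDim_eq_of_isIntegral hinj'
    rw [MvPolynomial.ringKrullDim_of_isNoetherianRing, ringKrullDim_eq_zero_of_field,
      Nat.card_eq_fintype_card, Fintype.card_fin, zero_add] at hdim
    rw [← hdim] at hE
    have : s + 1 ≤ d' + 1 := by exact_mod_cast hE
    omega
  -- lifts of the parameters, padded by zeros
  have hlift : ∀ k : Fin s, ∃ t : MvPolynomial (Fin n) K, Ideal.Quotient.mk E t = g (X k) :=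
    fun k => Ideal.Quotient.mk_surjective _
  choose t ht using hlift
  let T : Fin d' → MvPolynomial (Fin n) K := fun k => if h : (k : ℕ) < s then t ⟨k, h⟩ else 0
  have hT : ∀ k : Fin s, T (Fin.castLE hs k) = t k := fun k => by
    simp only [T, Fin.val_castLE, k.isLt, dif_pos, Fin.eta]
  let g' : MvPolynomial (Fin d') K →ₐ[K] (MvPolynomial (Fin n) K ⧸ E) :=
    aeval fun k => Ideal.Quotient.mk E (T k)
  have hg' : g = g'.comp (rename (Fin.castLE hs)) := by
    refine MvPolynomial.algHom_ext fun k => ?_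
    simp only [AlgHom.comp_apply, rename_X, g', aeval_X, hT, ht]
  -- each coordinate is integral over `g'`
  have hint : ∀ j : Fin n, ∃ q : (MvPolynomial (Fin d') K)[X], q.Monic ∧
      Polynomial.eval₂ (g' : MvPolynomial (Fin d') K →+* MvPolynomial (Fin n) K ⧸ E)
        (Ideal.Quotient.mk E (X j)) q = 0 := by
    intro j
    obtain ⟨p, hpmonic, hp⟩ := hgint (Ideal.Quotient.mk E (X j))
    refine ⟨p.map (rename (Fin.castLE hs) : MvPolynomial (Fin s) K →ₐ[K]
      MvPolynomial (Fin d') K).toRingHom, hpmonic.map _, ?_⟩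
    rw [Polynomial.eval₂_map]
    have hcomp : (g' : MvPolynomial (Fin d') K →+* MvPolynomial (Fin n) K ⧸ E).comp
        (rename (Fin.castLE hs) : MvPolynomial (Fin s) K →ₐ[K] MvPolynomial (Fin d') K).toRingHom =
        (g : MvPolynomial (Fin s) K →+* MvPolynomial (Fin n) K ⧸ E) := by
      rw [hg']; rfl
    rw [hcomp]
    exact hp
  choose q hqmonic hq using hint
  refine ⟨⟨T, fun j => (finSuccEquiv K d').symm (q j)⟩, fun x hx j => ?_,
    fun j => ⟨(q j).natDegree, ?_, ?_⟩⟩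
  · -- the cover
    change eval (Fin.cons (x j) (fun k => eval x (T k)) : Fin (d' + 1) → K)
      ((finSuccEquiv K d').symm (q j)) = 0
    rw [eval_cons_finSuccEquiv_symm, Polynomial.eval_map]
    have hker : ∀ a ∈ E, eval x a = 0 := hx
    let ex : MvPolynomial (Fin n) K ⧸ E →+* K := Ideal.Quotient.lift E (eval x) hker
    have hex : ex.comp (g' : MvPolynomial (Fin d') K →+* MvPolynomial (Fin n) K ⧸ E) =
        eval fun k => eval x (T k) := by
      refine MvPolynomial.ringHom_ext (fun c => ?_) (fun k => ?_)
      · show ex (g' (C c)) = eval (fun k => eval x (T k)) (C c)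
        rw [eval_C, MvPolynomial.algHom_C, ← Ideal.Quotient.mk_algebraMap, MvPolynomial.algebraMap_eq]
        show Ideal.Quotient.lift E (eval x) hker (Ideal.Quotient.mk E (C c)) = c
        rw [Ideal.Quotient.lift_mk, eval_C]
      · simp [ex, g']
    have h := congrArg ex (hq j)
    rw [Polynomial.hom_eval₂, hex, map_zero] at h
    simpa [ex] using h
  · rcases Nat.eq_zero_or_pos (q j).natDegree with h0 | hpos
    · exfalso
      have h1 : q j = 1 := (Polynomial.Monic.natDegree_eq_zero (hqmonic j)).mp h0
      have h2 := hq j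
      rw [h1, Polynomial.eval₂_one] at h2
      exact hEtop (Ideal.Quotient.zero_eq_one_iff.mp h2.symm)
    · exact hpos
  · unfold MonicIn0
    rw [AlgEquiv.apply_symm_apply]
    exact ⟨hqmonic j, rfl⟩


/-- The conclusion of the decomposition theorem for a point set `V ⊆ Kⁿ`: `V` is empty or has a
rational-trace decomposition of some complexity. [folklore] -/
def HasDecomposition (V : Set (Fin n → K)) : Prop :=
  V = ∅ ∨ ∃ B, Nonempty (Decomposition K n V B)

/-- Arithmetic in `WithBot ℕ∞`: `a ≤ b` and `b + 1 ≤ d` give `a + 1 ≤ d`. [folklore] -/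
theorem le_of_natCast_add_one_le {a d : ℕ} {b : WithBot ℕ∞} (hab : (a : WithBot ℕ∞) ≤ b)
    (h : b + 1 ≤ (d : ℕ)) : a + 1 ≤ d := by
  have h1 : (a : WithBot ℕ∞) + 1 ≤ (d : ℕ) := le_trans (add_le_add hab le_rfl) h
  exact_mod_cast h1

/-! ### The induction step -/

section Step

variable {d : ℕ} {ι κ : Type*}
  (P : ι → Ideal (MvPolynomial (Fin n) K)) (D : ∀ i, ModelData (P i) d)
  (E₀ : κ → Ideal (MvPolynomial (Fin n) K))

/-- The index of the exceptional ideals: top primes, pairs of distinct top primes, others. [folklore] -/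
abbrev ExcIdx (ι κ : Type*) : Type _ := ι ⊕ {ii' : ι × ι // ii'.1 ≠ ii'.2} ⊕ κ

/-- The exceptional ideals of the step: `P_i + (δ_i ρ_i)`, `P_i + P_{i'}` (`i ≠ i'`), and the
lower-dimensional members `E₀`. [folklore] -/
def excIdeal : ExcIdx ι κ → Ideal (MvPolynomial (Fin n) K)
  | Sum.inl i => (D i).exc
  | Sum.inr (Sum.inl ii') => P ii'.1.1 ⊔ P ii'.1.2
  | Sum.inr (Sum.inr l) => E₀ l

/-- The exceptional ideal of a top prime. [folklore] -/
@[simp] theorem excIdeal_inl (i : ι) : excIdeal P D E₀ (Sum.inl i) = (D i).exc := rfl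

/-- The exceptional ideal of a pair of distinct top primes. [folklore] -/
@[simp] theorem excIdeal_inr_inl (ii' : {ii' : ι × ι // ii'.1 ≠ ii'.2}) :
    excIdeal P D E₀ (Sum.inr (Sum.inl ii')) = P ii'.1.1 ⊔ P ii'.1.2 := rfl

/-- The lower-dimensional members are their own exceptional ideals. [folklore] -/
@[simp] theorem excIdeal_inr_inr (l : κ) : excIdeal P D E₀ (Sum.inr (Sum.inr l)) = E₀ l := rfl

/-- The exceptional set `W` of the step. [folklore] -/
def excSet : Set (Fin n → K) := ⋃ e, ratPoints (excIdeal P D E₀ e)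

variable {P D E₀}

/-- Rational points of an exceptional ideal are in the exceptional set. [folklore] -/
theorem mem_excSet_of_mem {x : Fin n → K} (e : ExcIdx ι κ)
    (hx : x ∈ ratPoints (excIdeal P D E₀ e)) : x ∈ excSet P D E₀ :=
  Set.mem_iUnion.mpr ⟨e, hx⟩

/-- Every exceptional ideal has dimension `< d`. [folklore] -/
theorem ringKrullDim_excIdeal (hP : ∀ i, (P i).IsPrime) (hinj : Function.Injective P)
    (hE₀ : ∀ l, ringKrullDim (MvPolynomial (Fin n) K ⧸ E₀ l) + 1 ≤ d) (e : ExcIdx ι κ) :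
    ringKrullDim (MvPolynomial (Fin n) K ⧸ excIdeal P D E₀ e) + 1 ≤ d := by
  rcases e with i | ⟨⟨i, i'⟩, hii'⟩ | l
  · haveI := hP i
    rw [excIdeal_inl]
    exact (D i).ringKrullDim_exc
  · rw [excIdeal_inr_inl]
    haveI := hP i
    haveI := hP i'
    have hlt := lt_sup_of_ringKrullDim_eq (D i).dim_eq (D i').dim_eq (hinj.ne hii')
    have h1 := ringKrullDim_quotient_add_one_le_of_lt hlt
    rwa [(D i).dim_eq] at h1
  · rw [excIdeal_inr_inr]
    exact hE₀ l

/-- **Step, good case.** If some top prime has an absolutely irreducible model, the union of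
the `V(P_i)` and `V(E₀ l)` has a rational-trace decomposition. [folklore] -/
theorem exists_decomposition_of_good [PerfectField K] [Fintype ι] [Fintype κ]
    (hP : ∀ i, (P i).IsPrime) (hinj : Function.Injective P)
    (hE₀ : ∀ l, ringKrullDim (MvPolynomial (Fin n) K ⧸ E₀ l) + 1 ≤ d)
    (hgood : ∃ i, IsAbsIrreducible (D i).piece.m) :
    ∃ B, Nonempty (Decomposition K n ((⋃ i, ratPoints (P i)) ∪ ⋃ l, ratPoints (E₀ l)) B) := by
  classical
  obtain ⟨i₀, hi₀⟩ := hgood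
  -- good indices
  let G := {i : ι // IsAbsIrreducible (D i).piece.m}
  haveI : Nonempty G := ⟨⟨i₀, hi₀⟩⟩
  -- charts (only when `d ≠ 0`)
  let κ' := {_e : ExcIdx ι κ // d ≠ 0}
  have hdim : ∀ e : κ', ringKrullDim (MvPolynomial (Fin n) K ⧸ excIdeal P D E₀ e.1) + 1 ≤
      ((d - 1 + 1 : ℕ) : WithBot ℕ∞) := fun e => by
    rw [Nat.sub_add_cancel (Nat.one_le_iff_ne_zero.mpr e.2)]
    exact ringKrullDim_excIdeal hP hinj hE₀ e.1
  have hchart := fun e : κ' => exists_chart (excIdeal P D E₀ e.1) (hdim e)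
  choose chart hcover hcmonic using hchart
  have hd : d ≤ n := by
    simpa using Fintype.card_le_of_embedding (D i₀).emb
  refine Decomposition.exists_of_fintype hd (fun g : G => (D g.1).piece) (excSet P D E₀) chart
    ?_ ?_ ?_ hcmonic (fun g => g.2) (fun g => (D g.1).δ_ne_zero) ?_ ?_ ?_
    (fun g => (D g.1).piece_param)
  · -- W is covered by the charts
    intro x hx
    obtain ⟨e, he⟩ := Set.mem_iUnion.mp hx
    by_cases hd0 : d = 0
    · exfalso
      have h := ringKrullDim_excIdeal hP hinj hE₀ e (D := D)
      have hd0' : (d : WithBot ℕ∞) = 0 := by exact_mod_cast hd0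
      rw [eq_top_of_ringKrullDim_add_one_le_zero (h.trans hd0'.le), ratPoints_top] at he
      exact he
    · exact ⟨⟨e, hd0⟩, hcover ⟨e, hd0⟩ x he⟩
  · intro hd0
    exact ⟨fun e => e.2 hd0⟩
  · intro g
    exact ⟨(D g.1).m.natDegree, (D g.1).natDegree_pos, (D g.1).piece_monicIn0⟩
  · -- (a)
    intro g x hx
    exact Or.inl (Set.mem_iUnion.mpr ⟨g.1, (D g.1).mem_ratPoints_of_piece_mem hx⟩)
  · -- (b)
    intro x hx
    rcases hx with hx | hx
    · obtain ⟨i, hi⟩ := Set.mem_iUnion.mp hx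
      by_cases hgi : IsAbsIrreducible (D i).piece.m
      · rcases (D i).piece_mem_or_mem_exc hi with h | h
        · exact Or.inr ⟨⟨i, hgi⟩, h⟩
        · exact Or.inl (mem_excSet_of_mem (Sum.inl i) h)
      · exact Or.inl (mem_excSet_of_mem (Sum.inl i) ((D i).mem_exc_of_bad hgi hi))
    · obtain ⟨l, hl⟩ := Set.mem_iUnion.mp hx
      exact Or.inl (mem_excSet_of_mem (Sum.inr (Sum.inr l)) hl)
  · -- (c)
    intro g g' x hgg' hg hg'
    have hne : g.1 ≠ g'.1 := fun h => hgg' (Subtype.ext h)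
    refine mem_excSet_of_mem (Sum.inr (Sum.inl ⟨(g.1, g'.1), hne⟩)) ?_
    rw [excIdeal_inr_inl]
    exact (D g.1).mem_ratPoints_sup_of_piece_mem (D g'.1) hg hg'

/-- **Step, bad case.** If no top prime has an absolutely irreducible model, the rational points
all lie on the exceptional ideals (of smaller dimension). [folklore] -/
theorem eq_of_bad [PerfectField K] (hbad : ∀ i, ¬ IsAbsIrreducible (D i).piece.m) :
    ((⋃ i, ratPoints (P i)) ∪ ⋃ l, ratPoints (E₀ l)) =
      (⋃ i, ratPoints (D i).exc) ∪ ⋃ l, ratPoints (E₀ l) := by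
  ext x
  simp only [Set.mem_union, Set.mem_iUnion]
  constructor
  · rintro (⟨i, hi⟩ | h)
    · exact Or.inl ⟨i, (D i).mem_exc_of_bad (hbad i) hi⟩
    · exact Or.inr h
  · rintro (⟨i, hi⟩ | h)
    · exact Or.inl ⟨i, ratPoints_mono (D i).lt_exc.le hi⟩
    · exact Or.inr h

end Step

/-! ### The induction on the dimension -/

/-- For a finite set of ideals of dimension `< d`, the union of their rational points has a
rational-trace decomposition (induction on `d`). [folklore] -/
theorem hasDecomposition_biUnion [PerfectField K] (d : ℕ) :
    ∀ S : Finset (Ideal (MvPolynomial (Fin n) K)),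
      (∀ I ∈ S, ringKrullDim (MvPolynomial (Fin n) K ⧸ I) + 1 ≤ d) →
        HasDecomposition (⋃ I ∈ S, ratPoints I) := by
  classical
  induction d with
  | zero =>
    intro S hS
    left
    ext x
    simp only [Set.mem_iUnion, Set.mem_empty_iff_false, iff_false, not_exists]
    intro I hI hx
    have h := hS I hI
    rw [Nat.cast_zero] at h
    rw [eq_top_of_ringKrullDim_add_one_le_zero h, ratPoints_top] at hx
    exact hx
  | succ d IH =>
    intro S hS
    -- all minimal primes of the members of `S`
    let Prm : Finset (Ideal (MvPolynomial (Fin n) K)) :=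
      S.biUnion fun I => (I.finite_minimalPrimes_of_isNoetherianRing).toFinset
    have hPrm : ∀ Q ∈ Prm, ∃ I ∈ S, Q ∈ I.minimalPrimes := fun Q hQ => by
      simpa [Prm] using hQ
    have hPrm' : ∀ I ∈ S, ∀ Q ∈ I.minimalPrimes, Q ∈ Prm := fun I hI Q hQ => by
      simp only [Prm, Finset.mem_biUnion, Set.Finite.mem_toFinset]
      exact ⟨I, hI, hQ⟩
    have hprime : ∀ Q ∈ Prm, Q.IsPrime := fun Q hQ => by
      obtain ⟨I, -, hQI⟩ := hPrm Q hQ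
      exact hQI.1.1
    have hdimQ : ∀ Q : ↥Prm, ∃ dQ : ℕ, ringKrullDim (MvPolynomial (Fin n) K ⧸ Q.1) = dQ ∧ dQ ≤ d := by
      intro Q
      haveI := hprime Q.1 Q.2
      obtain ⟨dQ, hdQ, -⟩ := exists_nat_ringKrullDim_quotient_eq Q.1
      obtain ⟨I, hI, hQI⟩ := hPrm Q.1 Q.2
      refine ⟨dQ, hdQ, ?_⟩
      have hle : ringKrullDim (MvPolynomial (Fin n) K ⧸ Q.1) ≤
          ringKrullDim (MvPolynomial (Fin n) K ⧸ I) :=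
        ringKrullDim_le_of_surjective (Ideal.Quotient.factor hQI.1.2)
          (Ideal.Quotient.factor_surjective hQI.1.2)
      rw [hdQ] at hle
      have := le_of_natCast_add_one_le hle (hS I hI)
      omega
    choose dN hdN hdNle using hdimQ
    -- top primes with model data, and the others
    let ι := {Q : ↥Prm // dN Q = d}
    let κ := {Q : ↥Prm // dN Q ≠ d}
    let P : ι → Ideal (MvPolynomial (Fin n) K) := fun i => i.1.1
    have hP : ∀ i, (P i).IsPrime := fun i => hprime _ i.1.2
    have hinj : Function.Injective P := fun i i' h => Subtype.ext (Subtype.ext h)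
    have hD : ∀ i : ι, Nonempty (ModelData (P i) d) := fun i => by
      haveI := hP i
      exact ModelData.nonempty (P i) (by rw [hdN i.1, i.2])
    let D : ∀ i : ι, ModelData (P i) d := fun i => Classical.choice (hD i)
    let E₀ : κ → Ideal (MvPolynomial (Fin n) K) := fun l => l.1.1
    have hE₀ : ∀ l, ringKrullDim (MvPolynomial (Fin n) K ⧸ E₀ l) + 1 ≤ d := fun l => by
      simp only [E₀]
      rw [hdN l.1]
      have h1 := hdNle l.1
      have h2 := l.2
      have : dN l.1 + 1 ≤ d := by omega
      exact_mod_cast this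
    -- the point set
    have hV : (⋃ I ∈ S, ratPoints I) = (⋃ i, ratPoints (P i)) ∪ ⋃ l, ratPoints (E₀ l) := by
      ext x
      simp only [Set.mem_iUnion, Set.mem_union]
      constructor
      · rintro ⟨I, hI, hx⟩
        obtain ⟨Q, hQ, hxQ⟩ := mem_ratPoints_iff_exists_minimalPrimes.mp hx
        have hQP : Q ∈ Prm := hPrm' I hI Q hQ
        by_cases htop : dN ⟨Q, hQP⟩ = d
        · exact Or.inl ⟨⟨⟨Q, hQP⟩, htop⟩, hxQ⟩
        · exact Or.inr ⟨⟨⟨Q, hQP⟩, htop⟩, hxQ⟩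
      · rintro (⟨i, hi⟩ | ⟨l, hl⟩)
        · obtain ⟨I, hI, hQI⟩ := hPrm _ i.1.2
          exact ⟨I, hI, ratPoints_mono hQI.1.2 hi⟩
        · obtain ⟨I, hI, hQI⟩ := hPrm _ l.1.2
          exact ⟨I, hI, ratPoints_mono hQI.1.2 hl⟩
    rw [hV]
    by_cases hgood : ∃ i, IsAbsIrreducible (D i).piece.m
    · exact Or.inr (exists_decomposition_of_good hP hinj hE₀ hgood)
    · push Not at hgood
      rw [eq_of_bad hgood]
      -- recurse on the exceptional ideals
      let S' : Finset (Ideal (MvPolynomial (Fin n) K)) :=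
        (Finset.univ.image fun i : ι => (D i).exc) ∪ Finset.univ.image fun l : κ => E₀ l
      have hS' : ∀ I ∈ S', ringKrullDim (MvPolynomial (Fin n) K ⧸ I) + 1 ≤ d := by
        intro I hI
        simp only [S', Finset.mem_union, Finset.mem_image, Finset.mem_univ, true_and] at hI
        rcases hI with ⟨i, rfl⟩ | ⟨l, rfl⟩
        · haveI := hP i
          exact (D i).ringKrullDim_exc
        · exact hE₀ l
      have h := IH S' hS'
      have hV' : (⋃ I ∈ S', ratPoints I) = (⋃ i, ratPoints (D i).exc) ∪ ⋃ l, ratPoints (E₀ l) := by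
        ext x
        simp only [S', Set.mem_iUnion, Set.mem_union, Finset.mem_union, Finset.mem_image,
          Finset.mem_univ, true_and]
        constructor
        · rintro ⟨I, ⟨i, rfl⟩ | ⟨l, rfl⟩, hx⟩
          · exact Or.inl ⟨i, hx⟩
          · exact Or.inr ⟨l, hx⟩
        · rintro (⟨i, hx⟩ | ⟨l, hx⟩)
          · exact ⟨_, Or.inl ⟨i, rfl⟩, hx⟩
          · exact ⟨_, Or.inr ⟨l, rfl⟩, hx⟩
      rwa [hV'] at h

/-- **Rational-trace decomposition of the rational points of an ideal** over a perfect field.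
[folklore] -/
theorem hasDecomposition_ratPoints [PerfectField K] (J : Ideal (MvPolynomial (Fin n) K)) :
    HasDecomposition (ratPoints J) := by
  classical
  let S := (J.finite_minimalPrimes_of_isNoetherianRing).toFinset
  have hS : ∀ I ∈ S, ringKrullDim (MvPolynomial (Fin n) K ⧸ I) + 1 ≤ ((n + 1 : ℕ) : WithBot ℕ∞) := by
    intro I hI
    have hI' : I ∈ J.minimalPrimes := by simpa [S] using hI
    haveI : I.IsPrime := hI'.1.1
    obtain ⟨dI, hdI, hle⟩ := exists_nat_ringKrullDim_quotient_eq I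
    rw [hdI]
    exact_mod_cast Nat.succ_le_succ hle
  have h := hasDecomposition_biUnion (n + 1) S hS
  have hV : (⋃ I ∈ S, ratPoints I) = ratPoints J := by
    ext x
    rw [mem_ratPoints_iff_exists_minimalPrimes]
    simp [S]
  rwa [hV] at h

/-- **Theorem A (rational-trace decomposition).** Over a perfect field `K`, the set of
`K`-rational solutions of a polynomial system `f₁ = … = f_r = 0` in `n` variables is empty or
admits a rational-trace decomposition (`Decomposition`) of some complexity `B`: good pieces
parametrised by the points of absolutely irreducible hypersurfaces `{m_i = 0, δ_i ≠ 0} ⊆ K^{1+d}`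
and a Noether cover of the rest by charts with `d - 1` parameters. [folklore] (Lang–Weil
reduction to hypersurfaces, Hartshorne I.4.9 + Noether normalisation, in coordinates.) -/
theorem exists_decomposition [PerfectField K] {r : ℕ} (f : Fin r → MvPolynomial (Fin n) K) :
    {x | ∀ i, eval x (f i) = 0} = ∅ ∨
      ∃ B, Nonempty (Decomposition K n {x | ∀ i, eval x (f i) = 0} B) := by
  have hV : ratPoints (Ideal.span (Set.range f)) = {x | ∀ i, eval x (f i) = 0} := by
    ext x
    rw [mem_ratPoints_iff, Ideal.span_le]
    simp only [Set.range_subset_iff, SetLike.mem_coe, RingHom.mem_ker, Set.mem_setOf_eq]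
  rw [← hV]
  exact hasDecomposition_ratPoints _

end Literature.NumberTheory.DiophantineGeometry

end
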